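import Mathlib
import Literature.MathematicalPhysics.QuantumFieldTheory.Dimock2011to13.BlockAveragingMatrix
import Literature.MathematicalPhysics.QuantumFieldTheory.Dimock2011to13.FreeFlowSingleStep
import Literature.MathematicalPhysics.QuantumFieldTheory.Dimock2011to13.ConstantFieldSplit

/-!
# Dimock, *The renormalization group according to Balaban* II, §3.11.1 LEMMA 3.10 (`\label{singsong1}`) «|W_k| ≤ Cp_k»:
# «A bound with Cp_kα_k^{−1} is easy. The issue is to eliminate the α_k^{−1}» — the ELIMINATION MECHANISM PROVED: a lattice
# function whose block averages are `O(p_k)` ((mars), from (ding2) and the characteristic functions) and whose gradient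
# is `O(p_k)` ((snickers)) is itself `O(p_k)` (sup-norm Poincaré on blocks), then `|W_k| ≤ C‖(C^{1/2})^{loc}W_k‖_∞` by
# (steaming); the random-walk inputs (not1), (salt), Lemma 3.2 and (steaming) stay the hypotheses they are

**Citation header (reproduction of PUBLISHED work; template of the Bałaban lattice Yang–Mills cell).**
J. Dimock, *The renormalization group according to Balaban II. Large fields*, J. Math. Phys. **54** (2013) 092301
(= arXiv:1212.5562v2) [Dimock2013BalabanII], §3.11 `\subsection{more estimates}`, §3.11.1 `\subsubsection{bounds on the
fluctuation field}` L3714–3912: the summary bounds (go1)∕(go2) L3722–3733, LEMMA 3.9 `\label{singsong2}` L3738–3767 with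
(ding) L3813–3817, LEMMA 3.10 `\label{singsong1}` (gb3) L3848–3854 (= Lemma 3.10 of §3; TEMPLATE §9), its Remark
L3857, proof L3860–3912 ((ding2) L3870–3872, (mars) L3875, (snickers) L3892–3895); LEMMA 3.6 `\label{stem}` (steaming)
L3440–3444.  TeX line numbers refer to the arXiv source held by the cell on this hub at
`run/shared/lean/archive/nearmiss/qft-balaban/dimock/src/1212.5562/1212.5562.tex` (7217 lines, sha256[:16]
75c5792fc48eacbc).  Dimock's papers are published and refereed and are the cell's TEMPLATE, not manuscripts under
audit; no quantity of the Bałaban series is touched.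

**What the paper prints (verbatim).**  LEMMA 3.10 L3848–3858: *"The bracketed characteristic functions in (pinky0)
enforce the inequality on Ω_{k+1} |W_k| ≤ Cp_k  (gb3)  Remark. A bound with Cp_kα_k^{−1} is easy. The issue is to eliminate
the α_k^{−1}."*  Proof L3860–3912: *"First note that χ^q_k(Ω_{k+1}) is now saying that on Ω_{k+1} |Φ_{k+1} − Q(Ψ^{loc}_{k,Ω_{k+1}}(Ω′)
+ (C^{1/2}_{k,Ω′})^{loc}W_k)| ≤ p_k  By (salt) this implies |Φ_{k+1} − Q(Ψ_{k,Ω_{k+1}}(Ω′) + (C^{1/2}_{k,Ω′})^{loc}W_k)| ≤ 2p_k  However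
(ding) can be rearranged to say Φ_{k+1} − QΨ_{k,Ω_{k+1}}(Ω′) = (a_k/(a_k + aL^{−2}))(Φ_{k+1} − Q_{k+1}φ⁰_{k+1,Ω′})  (ding2)  This is
bounded by Cp_k by (not1). Thus we have on Ω_{k+1} |Q(C^{1/2}_{k,Ω′})^{loc}W_k| ≤ Cp_k  (mars)  We supplement this with a bound on
∂(C^{1/2}_{k,Ω′})^{loc}W_k. For this we look to the bounds of χ_k(Ω_{k+1}) which say that (Φ_{k,δΩ_k}, Ψ^{loc}_{k,Ω_{k+1}}(Ω′) +
(C^{1/2}_{k,Ω′})^{loc}W) is in 𝒮_k(□) for any □ ⊂ Ω_{k+1}. By lemma threetwo this implies that on □̃ ∩ Ω_{k+1} |Ψ^{loc} +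
(C^{1/2})^{loc}W| ≤ 2p_kα_k^{−1}  |∂(Ψ^{loc} + (C^{1/2})^{loc}W)| ≤ 3p_k  By the previous lemma Ψ^{loc}_{k,Ω_{k+1}}(Ω′) alone satisfies
these bounds with constants Cp_kα_k^{−1}, Cp_k. Therefore on Ω_{k+1} |(C^{1/2}_{k,Ω′})^{loc}W_k| ≤ Cp_kα_k^{−1}  |∂(C^{1/2}_{k,Ω′})^{loc}W_k|
≤ Cp_k  (snickers)  Now by (mars) and the second bound in (snickers) we have |(C^{1/2}_{k,Ω′})^{loc}W_k| ≤ |(C^{1/2}_{k,Ω′})^{loc}W_k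
− Q(C^{1/2}_{k,Ω′})^{loc}W_k| + |Q(C^{1/2}_{k,Ω′})^{loc}W_k| ≤ Cp_k  Finally the bound on W_k follows from this result and
(steaming) which gives |W_k| = |[(C^{1/2}_{k,Ω′})^{loc}]^{−1}(C^{1/2}_{k,Ω′})^{loc}W_k| ≤ C‖(C^{1/2}_{k,Ω′})^{loc}W_k‖_∞ ≤ Cp_k  This
completes the proof."*  (steaming) L3440–3444: *"C^{1/2}_{k,Ω′} and (C^{1/2}_{k,Ω′})^{loc} are invertible and |C^{−1/2}_{k,Ω′}f|,
|[(C^{1/2}_{k,Ω′})^{loc}]^{−1}f| ≤ C‖f‖_∞"*.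

**Why this module.**  §3.11 (*"more estimates"*, LEMMAS 3.9–3.14) has no row of its own in TEMPLATE.md §4.2 (row «D2
§3.10» mentions §3.11.2∕§3.11.3) and had no kernel object.  LEMMA 3.10 is the one place where the small-field bound on
the fluctuation variable `W_k` is recovered on ALL of `Ω_{k+1}` from the characteristic functions, and Dimock flags its
point: the naive bound carries `α_k^{−1} = min{μ̄_k^{−1/2}, λ_k^{−1/4}}`, which must be eliminated.  The elimination is
elementary and reusable — a lattice function is controlled in sup norm by its BLOCK AVERAGES plus its OSCILLATION on
blocks, and the oscillation by the gradient times the block diameter — while the inputs ((not1)∕(salt) of LEMMA 3.9,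
LEMMA 3.2, (steaming)) are random-walk estimates.  This module proves the elimination mechanism and the chain of
triangle inequalities around it, with those inputs as hypotheses, in the block formalism of `BlockAveragingMatrix`
(`QD`, `fibre`) and with the graph-Lipschitz lemma of `ConstantFieldSplit`; (ding2) is the sibling
`FreeFlowSingleStep.sub_Q_mulVec_Psi` by name.

**What is reproduced here (kernel-checked, zero `sorry`).**
* §1 THE ELIMINATION MECHANISM: **`abs_sub_QD_le`** (`|f(x) − (Qf)(b x)| ≤ δ` when `f` oscillates by `≤ δ` on blocks — *"|f −
  Qf|"*), **`abs_le_of_QD_of_osc`** ∕ `norm_le_of_QD_of_osc` (`|Qf| ≤ A`, oscillation `≤ δ` ⟹ `‖f‖_∞ ≤ A + δ`), **`osc_le_of_adj`**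
  (gradient `≤ p` on the edges of a connected graph, blocks of diameter `≤ D` ⟹ oscillation `≤ pD`;
  `ConstantFieldSplit.abs_sub_le_mul_dist`), **`norm_le_of_QD_of_adj`** (`‖f‖_∞ ≤ A + pD` — no `α_k^{−1}`).
* §2 (ding2) is `FreeFlowSingleStep.sub_Q_mulVec_Psi` BY NAME (`Φ_{k+1} − QΨ = (a_k/(a_k+aL))(Φ_{k+1} − Q_{k+1}φ⁰)`);
  `norm_sub_Q_Psi_le` (hence `‖Φ_{k+1} − QΨ‖_∞ ≤ ‖Φ_{k+1} − Q_{k+1}φ⁰‖_∞`), **`mars`** (`‖Φ′ − Q(Ψ^{loc} + V)‖ ≤ p`, `‖Q(Ψ^{loc} − Ψ)‖ ≤ p`, `‖Φ′ − QΨ‖ ≤ C₁p`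
  ⟹ `‖QV‖ ≤ (C₁ + 2)p`, any additive `Q`, any seminormed groups).
* §3 **`snickers`**, **`snickers_deriv`** (`‖Ψ^{loc} + V‖ ≤ c·a`, `‖Ψ^{loc}‖ ≤ C·a` ⟹ `‖V‖ ≤ (C + c)·a`; the same through a
  linear `∂`).
* §4 `norm_le_of_inverse_bound` ((steaming) applied: `W = MV`, `‖Mg‖_∞ ≤ C_inv‖g‖_∞` ⟹ `‖W‖_∞ ≤ C_inv‖V‖_∞`);
  **`lemma_singsong1`**: blocks of equal size, nearest-neighbour graph, block diameter `≤ D`, `|(QV)(y)| ≤ Ap_k` ((mars)),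
  `|∂V| ≤ Bp_k` ((snickers)), (steaming) ⟹ `‖W_k‖_∞ ≤ C_inv(A + BD)p_k`.
* §5 a two-site non-vacuity `example` (`f = (1, −1)`: average `0`, oscillation `2`, `|f| ≤ 0 + 2`).

**Readings / located items (declared).**  (i) The print's "Q" in (mars) and in *"|f − Qf| + |Qf|"* is the one-step
averaging to the `L`-lattice; `|f − Qf|` at a fine point compares `f(x)` with the average over the block of `x`
(`QD b N f (b x)`), bounded by the oscillation — the print bounds it by the gradient bound of (snickers) without stating
the block diameter; here `D` is explicit (for `L`-blocks of `ℤ^d` in the ℓ¹ path metric `D = d(L − 1)`; not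
instantiated).  (ii) The inputs are hypotheses in the shape the proof uses them: block averages of `V = (C^{1/2})^{loc}W_k`
bounded by `Ap_k` (= (mars), itself `mars` from `χ^q_k`, (salt), (ding2)+(not1)), edge increments of `V` bounded by `Bp_k`
(= (snickers)'s second half, itself `snickers_deriv` from LEMMA 3.2 and LEMMA 3.9), and the inverse bound (steaming) as
a sup-norm operator bound of a linear `M` with `W_k = MV`.  (iii) `mars`∕`snickers` are stated in arbitrary seminormed
groups (sup norms on the relevant lattices in the print).

**What is NOT claimed.**  LEMMA 3.9 `singsong2` ((not1), (skunky2), (swish), (salt) — random-walk estimates), LEMMA 3.2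
(the `𝒮_k(□)` ⟹ bounds step; row «D2 Def s …»), LEMMA 3.6 (steaming) (row «D2 §3.8»), the identification of the
block-diameter constant, the first (easy, `α_k^{−1}`-carrying) half of (snickers) beyond `snickers`; anything of B1–B16.
NOT summit progress; NOT a statement about any Bałaban paper; NOT continuum; NOT Clay.  NEW leaf; imports Mathlib +
`BlockAveragingMatrix` + `FreeFlowSingleStep` + `ConstantFieldSplit`; no Summits import; modifies nothing.  Unit
`b2b-balaban-template` gen 36 (journal CLAIM D2-SINGSONG1-KERNEL).

**Version.**  v1 (gen 36, literature-prover-b2b-balaban-template-g36-0, 2026-08-20).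
-/

noncomputable section

open Finset

namespace Literature.MathematicalPhysics.QuantumFieldTheory.Dimock2011to13.FluctuationFieldBound

open Matrix
open Literature.MathematicalPhysics.QuantumFieldTheory.Dimock2011to13.BlockAveragingMatrix
open Literature.MathematicalPhysics.QuantumFieldTheory.Dimock2011to13.FreeFlowSingleStep
open Literature.MathematicalPhysics.QuantumFieldTheory.Dimock2011to13.ConstantFieldSplit

/-! ## §1 Sup-norm Poincaré on blocks: `|f| ≤ |f − Qᵀ Q f| + |Q f|` and the oscillation from the gradient -/

section Poincare

variable {ι σ : Type*} [Fintype ι] [DecidableEq σ]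

/-- **the deviation from the block average is bounded by the oscillation on the block**: if `|f(x) − f(x′)| ≤ δ` whenever
`x, x′` lie in the same block, then `|f(x) − (Qf)(b x)| ≤ δ` (`(Qf)(y) = N⁻¹Σ_{x′∈B(y)}f(x′)`, `|B(y)| = N > 0`).
[cite: Dimock2013BalabanII, §3.11.1 Lemma singsong1 proof L3900–3906 «|(C^{1/2})^{loc}W_k| ≤ |(C^{1/2})^{loc}W_k −
Q(C^{1/2})^{loc}W_k| + |Q(C^{1/2})^{loc}W_k| ≤ Cp_k» (arXiv:1212.5562v2 TeX)] -/
theorem abs_sub_QD_le {b : ι → σ} {N : ℕ} (hb : ∀ y, (fibre b y).card = N) (hN : 0 < N) {f : ι → ℝ} {δ : ℝ}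
    (hosc : ∀ x x', b x = b x' → |f x - f x'| ≤ δ) (x : ι) : |f x - QD b N f (b x)| ≤ δ := by
  have hNr : (0 : ℝ) < N := by exact_mod_cast hN
  have hcard := hb (b x)
  -- f x − N⁻¹Σ f x′ = N⁻¹ Σ (f x − f x′)
  have e : f x - QD b N f (b x) = (N : ℝ)⁻¹ * ∑ x' ∈ fibre b (b x), (f x - f x') := by
    unfold QD
    rw [Finset.sum_sub_distrib, Finset.sum_const, hcard, nsmul_eq_mul, mul_sub, ← mul_assoc,
      inv_mul_cancel₀ hNr.ne', one_mul]
  rw [e, abs_mul, abs_of_pos (inv_pos.2 hNr)]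
  calc (N : ℝ)⁻¹ * |∑ x' ∈ fibre b (b x), (f x - f x')|
      ≤ (N : ℝ)⁻¹ * ∑ x' ∈ fibre b (b x), |f x - f x'| :=
        mul_le_mul_of_nonneg_left (Finset.abs_sum_le_sum_abs _ _) (inv_pos.2 hNr).le
    _ ≤ (N : ℝ)⁻¹ * ∑ _x' ∈ fibre b (b x), δ :=
        mul_le_mul_of_nonneg_left (Finset.sum_le_sum fun x' hx' => hosc x x' (mem_fibre.mp hx').symm)
          (inv_pos.2 hNr).le
    _ = δ := by rw [Finset.sum_const, hcard, nsmul_eq_mul, ← mul_assoc, inv_mul_cancel₀ hNr.ne', one_mul]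

/-- **«|f| ≤ |f − Qf| + |Qf|»**: block averages `≤ A` and oscillation on blocks `≤ δ` give `|f(x)| ≤ A + δ` — NO `α_k^{−1}`.
[cite: Dimock2013BalabanII, §3.11.1 Lemma singsong1 proof L3900–3906 (arXiv:1212.5562v2 TeX)] -/
theorem abs_le_of_QD_of_osc {b : ι → σ} {N : ℕ} (hb : ∀ y, (fibre b y).card = N) (hN : 0 < N) {f : ι → ℝ}
    {A δ : ℝ} (havg : ∀ y, |QD b N f y| ≤ A) (hosc : ∀ x x', b x = b x' → |f x - f x'| ≤ δ) (x : ι) :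
    |f x| ≤ A + δ := by
  calc |f x| = |(f x - QD b N f (b x)) + QD b N f (b x)| := by rw [sub_add_cancel]
    _ ≤ |f x - QD b N f (b x)| + |QD b N f (b x)| := abs_add_le _ _
    _ ≤ δ + A := add_le_add (abs_sub_QD_le hb hN hosc x) (havg _)
    _ = A + δ := add_comm _ _

/-- the sup-norm form: `‖f‖_∞ ≤ A + δ`. [cite: Dimock2013BalabanII, §3.11.1 Lemma singsong1 proof L3900–3906
(arXiv:1212.5562v2 TeX)] -/
theorem norm_le_of_QD_of_osc {b : ι → σ} {N : ℕ} (hb : ∀ y, (fibre b y).card = N) (hN : 0 < N) {f : ι → ℝ}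
    {A δ : ℝ} (hA : 0 ≤ A) (hδ : 0 ≤ δ) (havg : ∀ y, |QD b N f y| ≤ A)
    (hosc : ∀ x x', b x = b x' → |f x - f x'| ≤ δ) : ‖f‖ ≤ A + δ :=
  (pi_norm_le_iff_of_nonneg (add_nonneg hA hδ)).2 fun x => by
    rw [Real.norm_eq_abs]; exact abs_le_of_QD_of_osc hb hN havg hosc x

omit [Fintype ι] [DecidableEq σ] in
/-- **the oscillation from the gradient**: if `|∂f| ≤ p` along the edges of a connected graph on the sites and every block
has diameter `≤ D` in the graph distance, the oscillation on blocks is `≤ p·D` (the bound `|∂(C^{1/2})^{loc}W_k| ≤ Cp_k` of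
(snickers) enters here; `D` = the diameter of an `L`-block).  Uses `ConstantFieldSplit.abs_sub_le_mul_dist`.
[cite: Dimock2013BalabanII, §3.11.1 Lemma singsong1 proof (snickers) L3881–3906 (arXiv:1212.5562v2 TeX)] -/
theorem osc_le_of_adj {G : SimpleGraph ι} (hconn : G.Connected) {b : ι → σ} {f : ι → ℝ} {p : ℝ} (hp : 0 ≤ p)
    (hadj : ∀ u v, G.Adj u v → |f u - f v| ≤ p) {D : ℕ} (hdiam : ∀ x x', b x = b x' → G.dist x x' ≤ D)
    (x x' : ι) (hxx' : b x = b x') : |f x - f x'| ≤ p * D :=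
  (abs_sub_le_mul_dist hconn hadj x x').trans
    (mul_le_mul_of_nonneg_left (by exact_mod_cast hdiam x x' hxx') hp)

/-- **THE ELIMINATION OF `α_k^{−1}`**: `|Qf| ≤ A` on the blocks and `|∂f| ≤ p` (blocks of diameter `≤ D`) ⟹ `‖f‖_∞ ≤ A + pD`
— applied to `f = (C^{1/2}_{k,Ω′})^{loc}W_k` with `A = Cp_k` (mars) and `p = Cp_k` (snickers) this is `‖(C^{1/2})^{loc}W_k‖_∞ ≤
Cp_k` WITHOUT the `α_k^{−1}` of the direct bound. [cite: Dimock2013BalabanII, §3.11.1 Lemma singsong1 L3848–3858 «Remark. A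
bound with Cp_kα_k^{−1} is easy. The issue is to eliminate the α_k^{−1}» and proof L3900–3906 (arXiv:1212.5562v2 TeX)] -/
theorem norm_le_of_QD_of_adj {G : SimpleGraph ι} (hconn : G.Connected) {b : ι → σ} {N : ℕ}
    (hb : ∀ y, (fibre b y).card = N) (hN : 0 < N) {f : ι → ℝ} {A p : ℝ} (hA : 0 ≤ A) (hp : 0 ≤ p)
    (havg : ∀ y, |QD b N f y| ≤ A) (hadj : ∀ u v, G.Adj u v → |f u - f v| ≤ p) {D : ℕ}
    (hdiam : ∀ x x', b x = b x' → G.dist x x' ≤ D) : ‖f‖ ≤ A + p * D :=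
  norm_le_of_QD_of_osc hb hN hA (by positivity) havg (osc_le_of_adj hconn hp hadj hdiam)

end Poincare

/-! ## §2 (ding2) and (mars): the block averages of `(C^{1/2})^{loc}W_k` are `O(p_k)` -/

section Mars

variable {κ ι σ : Type*} [Fintype κ] [Fintype ι] [Fintype σ] [DecidableEq σ]
variable {Qk : Matrix ι κ ℝ} {Q : Matrix σ ι ℝ} {ak aL : ℝ}

/- **(ding2)** `Φ_{k+1} − QΨ_{k,Ω_{k+1}}(Ω′) = (a_k/(a_k + aL^{−2}))(Φ_{k+1} − Q_{k+1}φ⁰_{k+1,Ω′})` (L3869–3873), the rearrangement of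
(ding) L3813–3817, IS the sibling's (potpie) `FreeFlowSingleStep.sub_Q_mulVec_Psi` (`Ψ = Psi Q_k Q a_k aL Φ_{k+1} φ⁰`,
`Q_{k+1} = QQ_k`) and is used below BY NAME (not restated). -/

/-- hence `‖Φ_{k+1} − QΨ‖_∞ ≤ ‖Φ_{k+1} − Q_{k+1}φ⁰‖_∞` (the factor `a_k/(a_k + aL^{−2}) ∈ [0,1]`) — *"This is bounded by Cp_k by
(not1)"*. [cite: Dimock2013BalabanII, §3.11.1 Lemma singsong1 proof L3869–3874 (arXiv:1212.5562v2 TeX)] -/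
theorem norm_sub_Q_Psi_le (hQ : Q * Qᵀ = 1) (hak : 0 < ak) (haL : 0 ≤ aL) (Φ' : σ → ℝ) (φ : κ → ℝ) :
    ‖Φ' - Q *ᵥ Psi Qk Q ak aL Φ' φ‖ ≤ ‖Φ' - Q *ᵥ (Qk *ᵥ φ)‖ := by
  rw [sub_Q_mulVec_Psi hQ (by linarith) Φ' φ, norm_smul, Real.norm_eq_abs, abs_of_nonneg (by positivity)]
  refine mul_le_of_le_one_left (norm_nonneg _) ?_
  rw [div_le_one (by linarith)]
  linarith

/-- **(mars)**: `|Φ_{k+1} − Q(Ψ^{loc} + V)| ≤ p_k` (the characteristic function `χ^q_k(Ω_{k+1})`, `V = (C^{1/2})^{loc}W_k`), `|Q(Ψ^{loc}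
− Ψ)| ≤ p_k` ((salt): `|δΨ| ≤ e^{−r_{k+1}}`, and `Q` contracts the sup norm) and `|Φ_{k+1} − QΨ| ≤ C₁p_k` ((ding2) + (not1)) give
`|QV| ≤ (C₁ + 2)p_k` — for any linear `Q`, pure triangle inequalities. [cite: Dimock2013BalabanII, §3.11.1 Lemma singsong1
proof L3861–3876 «(mars)» (arXiv:1212.5562v2 TeX)] -/
theorem mars {E F : Type*} [SeminormedAddCommGroup E] [SeminormedAddCommGroup F] (Qop : E →+ F) {Φ' : F}
    {Ψl Ψ V : E} {p C₁ : ℝ} (hchi : ‖Φ' - Qop (Ψl + V)‖ ≤ p) (hsalt : ‖Qop (Ψl - Ψ)‖ ≤ p)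
    (hding : ‖Φ' - Qop Ψ‖ ≤ C₁ * p) : ‖Qop V‖ ≤ (C₁ + 2) * p := by
  have e : Qop V = (Φ' - Qop Ψ) - (Φ' - Qop (Ψl + V)) - Qop (Ψl - Ψ) := by
    rw [map_add, map_sub]; abel
  rw [e]
  calc ‖(Φ' - Qop Ψ) - (Φ' - Qop (Ψl + V)) - Qop (Ψl - Ψ)‖
      ≤ ‖(Φ' - Qop Ψ) - (Φ' - Qop (Ψl + V))‖ + ‖Qop (Ψl - Ψ)‖ := norm_sub_le _ _
    _ ≤ (‖Φ' - Qop Ψ‖ + ‖Φ' - Qop (Ψl + V)‖) + ‖Qop (Ψl - Ψ)‖ := by gcongr; exact norm_sub_le _ _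
    _ ≤ (C₁ * p + p) + p := by gcongr
    _ = (C₁ + 2) * p := by ring

end Mars

/-! ## §3 (snickers): bounds on `V = (C^{1/2})^{loc}W_k` from bounds on `Ψ^{loc} + V` and on `Ψ^{loc}` -/

section Snickers

/-- **(snickers)**: `‖Ψ^{loc} + V‖ ≤ 2p_kα_k^{−1}` (Lemma 3.2 applied to `χ_k(Ω_{k+1})`) and `‖Ψ^{loc}‖ ≤ Cp_kα_k^{−1}` (Lemma 3.9) give
`‖V‖ ≤ (C + 2)p_kα_k^{−1}`; the same with `∂` (a linear map) and the constants `3p_k`, `Cp_k` gives `‖∂V‖ ≤ (C + 3)p_k`.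
[cite: Dimock2013BalabanII, §3.11.1 Lemma singsong1 proof (snickers) L3881–3895 (arXiv:1212.5562v2 TeX)] -/
theorem snickers {E : Type*} [SeminormedAddCommGroup E] {Ψl V : E} {a c C : ℝ} (hsum : ‖Ψl + V‖ ≤ c * a)
    (hΨ : ‖Ψl‖ ≤ C * a) : ‖V‖ ≤ (C + c) * a := by
  have e : V = (Ψl + V) - Ψl := by abel
  rw [e]
  calc ‖Ψl + V - Ψl‖ ≤ ‖Ψl + V‖ + ‖Ψl‖ := norm_sub_le _ _
    _ ≤ c * a + C * a := add_le_add hsum hΨ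
    _ = (C + c) * a := by ring

/-- the derivative version through a linear `∂`: `‖∂(Ψ^{loc} + V)‖ ≤ 3p_k`, `‖∂Ψ^{loc}‖ ≤ Cp_k` ⟹ `‖∂V‖ ≤ (C + 3)p_k`.
[cite: Dimock2013BalabanII, §3.11.1 Lemma singsong1 proof (snickers) L3881–3895 (arXiv:1212.5562v2 TeX)] -/
theorem snickers_deriv {E F : Type*} [SeminormedAddCommGroup E] [SeminormedAddCommGroup F] (deriv : E →+ F)
    {Ψl V : E} {p c C : ℝ} (hsum : ‖deriv (Ψl + V)‖ ≤ c * p) (hΨ : ‖deriv Ψl‖ ≤ C * p) :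
    ‖deriv V‖ ≤ (C + c) * p := by
  have e : deriv V = deriv (Ψl + V) - deriv Ψl := by rw [map_add]; abel
  rw [e]
  calc ‖deriv (Ψl + V) - deriv Ψl‖ ≤ ‖deriv (Ψl + V)‖ + ‖deriv Ψl‖ := norm_sub_le _ _
    _ ≤ c * p + C * p := add_le_add hsum hΨ
    _ = (C + c) * p := by ring

end Snickers

/-! ## §4 LEMMA 3.10 assembled: `|W_k| ≤ C‖(C^{1/2})^{loc}W_k‖_∞ ≤ Cp_k` -/

section Assembly

variable {ι σ : Type*} [Fintype ι] [DecidableEq σ]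

/-- **(steaming) applied**: `|W_k| = |[(C^{1/2})^{loc}]^{−1}(C^{1/2})^{loc}W_k| ≤ C_inv‖(C^{1/2})^{loc}W_k‖_∞` — for `W = MV` with `M`
a sup-norm bounded linear map (`‖Mg‖_∞ ≤ C_inv‖g‖_∞`, the printed `|[(C^{1/2})^{loc}]^{−1}f| ≤ C‖f‖_∞`).
[cite: Dimock2013BalabanII, §3.11.1 Lemma singsong1 proof L3907–3911 and Lemma stem (steaming) L3440–3444
(arXiv:1212.5562v2 TeX)] -/
theorem norm_le_of_inverse_bound {W V : ι → ℝ} (M : (ι → ℝ) →ₗ[ℝ] (ι → ℝ)) {Cinv : ℝ}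
    (hM : ∀ g : ι → ℝ, ‖M g‖ ≤ Cinv * ‖g‖) (hW : W = M V) : ‖W‖ ≤ Cinv * ‖V‖ := by
  rw [hW]; exact hM V

/-- **LEMMA 3.10 `singsong1`, ASSEMBLED**: with `V = (C^{1/2}_{k,Ω′})^{loc}W_k` on the unit lattice `ι = Ω^{(k)}_{k+1}` (blocks `b : ι →
σ` of equal size `N > 0` = the `L`-blocks, nearest-neighbour graph `G`, block diameter `≤ D`), the hypotheses of the
printed proof — block averages `|(QV)(y)| ≤ Ap_k` ((mars)), gradient `|∂V| ≤ Bp_k` on edges ((snickers)), and the inverse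
bound `‖[(C^{1/2})^{loc}]^{−1}g‖_∞ ≤ C_inv‖g‖_∞` ((steaming)) with `W_k = [(C^{1/2})^{loc}]^{−1}V` — give `‖W_k‖_∞ ≤ C_inv(A + BD)p_k`:
the constant carries NO `α_k^{−1}`. [cite: Dimock2013BalabanII, §3.11.1 Lemma singsong1 (gb3) L3848–3854 and proof
L3860–3912 (arXiv:1212.5562v2 TeX)] -/
theorem lemma_singsong1 {G : SimpleGraph ι} (hconn : G.Connected) {b : ι → σ} {N : ℕ}
    (hb : ∀ y, (fibre b y).card = N) (hN : 0 < N) {D : ℕ} (hdiam : ∀ x x', b x = b x' → G.dist x x' ≤ D)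
    {V W : ι → ℝ} {p A B Cinv : ℝ} (hp : 0 ≤ p) (hA : 0 ≤ A) (hB : 0 ≤ B) (hCinv : 0 ≤ Cinv)
    (hmars : ∀ y, |QD b N V y| ≤ A * p) (hsnickers : ∀ u v, G.Adj u v → |V u - V v| ≤ B * p)
    (M : (ι → ℝ) →ₗ[ℝ] (ι → ℝ)) (hsteaming : ∀ g : ι → ℝ, ‖M g‖ ≤ Cinv * ‖g‖) (hW : W = M V) :
    ‖W‖ ≤ Cinv * (A + B * D) * p := by
  have hV : ‖V‖ ≤ A * p + B * p * D :=
    norm_le_of_QD_of_adj hconn hb hN (mul_nonneg hA hp) (mul_nonneg hB hp) hmars hsnickers hdiam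
  calc ‖W‖ ≤ Cinv * ‖V‖ := norm_le_of_inverse_bound M hsteaming hW
    _ ≤ Cinv * (A * p + B * p * D) := mul_le_mul_of_nonneg_left hV hCinv
    _ = Cinv * (A + B * D) * p := by ring

end Assembly

/-! ## §5 Non-vacuity -/

/-- two sites in one block (`b ≡ ()`, `N = 2`): `f = (1, −1)` has block average `0` (`A = 0`) and oscillation `2` (`δ = 2`);
`abs_le_of_QD_of_osc` gives `|f x| ≤ 0 + 2`, and indeed `|f x| = 1`. -/
example : ∀ x : Bool, |(fun x : Bool => if x then (1 : ℝ) else -1) x| ≤ 0 + 2 := by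
  refine abs_le_of_QD_of_osc (b := fun _ : Bool => ()) (N := 2) (fun _ => by simp [fibre]) (by norm_num) ?_ ?_
  · intro y
    simp [QD, fibre]
  · intro x x' _
    cases x <;> cases x' <;> norm_num

end Literature.MathematicalPhysics.QuantumFieldTheory.Dimock2011to13.FluctuationFieldBound
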